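import Mathlib
import HarnessLib
import Summits.NavierStokesRegularity.NavierStokesRegularity.Theorems.PoloidalWindowDoorLrcModEntireTHCertExtra

/-!
# Route `PoloidalWindowDoor`, item `LrcModEntire` (stmt-NavierStokesRegularity-20428) — the (TH) local datum of the STEADY, NON-UMBILIC sub-case
# (closer template for the steady core-ideal certificate; kernel-port lane of DIRECTOR-NS #81 (1)(b))

Cell ns-regularity-ideate, seat ns-poloidal-K2-p3 gen 8 (LEAD of item 20428; `--supports stmt-NavierStokesRegularity-20428`).  The registered stub of the (TH)
column is `stub_localTHEmptyHypNUG` (skeleton `Cruxes/LrcModEntire/Lines/twist_split.lean` v4.2: the local (TH)∩twisting system is empty at a hyperbolic,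
NON-UMBILIC rest base point).  The first exact-elimination verdict the engines can deliver is for its STEADY sub-system (cert-1 g4/B CERT-MEMO-4 §11: the
steady core ideal, 77 explicit slice-letter laws through weight 11, localised at `ε(1−ε)·twist·|Φ₂|²·μ_z`; ns-poloidal-K2-p2 g7's Gröbner lane; the
two-engine rule of DIRECTOR-NS #83 (2)).  This file is the KERNEL CLOSER TEMPLATE for that verdict:

* `steadyLaws L = [∂ₜu₂, ∂ₜμ]` (single letters) — the two extra hypothesis laws of the steady sub-system; every `t`-letter the checker meets when it
  differentiates `E` along `x, y, z` is one of their derivatives, so a certificate adds the needed rewrite laws itself (`steadyLaws_vanish`);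
* `pinNonUmbilic L = (∂ₓu₀ − ∂_yu₁)² + 4(∂_yu₀)²` — the non-umbilic pin of the registered statement as ONE polynomial (`pinNonUmbilic_ne_zero`:
  non-zero at `p₀` from the stub's disjunction `∂₀u₀(p₀) ≠ ∂₁u₁(p₀) ∨ ∂₁u₀(p₀) ≠ 0`); in cert-1's complex slice letters it is `16·f₀₂f₂₀`;
* `thSteadyNULocalDatum` — `LocalDatum … (thHyps L ++ steadyLaws L) (thPins L ++ [pinNonUmbilic L])` from the stub's data plus steadiness;
* `steadyNU_false_of_checkTreeC` / `…S` — a checked tree against `thHyps L ++ steadyLaws L ++ Ts` and `thPins L ++ [pinNonUmbilic L]` closes the goal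
  (after the usual chunk folding `localDatum_extendS` / `localDatum_cancelS` for the certified laws `Ts`);
* `steady_localTHEmptyHypNUG_of_checkTreeC` — THE BY-NAME TEMPLATE: the registered statement `stub_localTHEmptyHypNUG` with two more hypotheses
  («`∂ₜu₂ = 0` and `∂ₜμ = 0` on `U`») follows from any certificate tree `t` with `checkTreeC … (thHyps L ++ steadyLaws L) (thPins L ++ [pinNonUmbilic L]) t
  = true` (no chunks; with chunks use the two lemmas above, recipe in the seat's cert2lean).

WHAT THIS IS NOT: not a claim about Navier–Stokes, not a certificate, and not the registered stub (which is unsteady) — the steady sub-case's plumbing.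
[folklore]
-/

noncomputable section

-- the summit and its single sub-problem share the name (CONVENTIONS §1), as in every Theorems file
set_option linter.dupNamespace false

namespace Summit.NavierStokesRegularity.NavierStokesRegularity.Theorems.PoloidalWindowDoorLrcModEntireTHCertSteady

open _root_.Topology _root_.Filter Set Function
open scoped InnerProductSpace Laplacian
open Literature.Analysis.ValidatedNumerics
open Summit.NavierStokesRegularity.NavierStokesRegularity.Theorems.PoloidalWindowDoorLrcModEntireJetCertDefs
open Summit.NavierStokesRegularity.NavierStokesRegularity.Theorems.PoloidalWindowDoorLrcModEntireJetCertTree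
open Summit.NavierStokesRegularity.NavierStokesRegularity.Theorems.PoloidalWindowDoorLrcModEntireJetCertFast2
open Summit.NavierStokesRegularity.NavierStokesRegularity.Theorems.PoloidalWindowDoorLrcModEntireJetCertCancel
open Summit.NavierStokesRegularity.NavierStokesRegularity.Theorems.PoloidalWindowDoorLrcModEntireTHCertLetters
open Summit.NavierStokesRegularity.NavierStokesRegularity.Theorems.PoloidalWindowDoorLrcModEntireTHCertDictionary
open Summit.NavierStokesRegularity.NavierStokesRegularity.Theorems.PoloidalWindowDoorLrcModEntireTHCert
open Summit.NavierStokesRegularity.NavierStokesRegularity.Theorems.PoloidalWindowDoorLrcModEntireTHCertFast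
open Summit.NavierStokesRegularity.NavierStokesRegularity.Theorems.PoloidalWindowDoorLrcModEntireTHCertExtra

/-! ### The steady extra laws and the non-umbilic pin -/

/-- The two STEADY hypothesis laws `[∂ₜu₂, ∂ₜμ]` (single-letter polynomials `W 2 1 0 0 0`, `M 1 0`). [folklore] -/
def steadyLaws (L : List THLetter) : List QMvPoly := [V L (.W 2 1 0 0 0), V L (.M 1 0)]

/-- The non-umbilic pin `Π_NU = (∂ₓu₀ − ∂_yu₁)² + 4(∂_yu₀)²` (`= 16 f₀₂ f₂₀` in complex slice letters). [folklore] -/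
def pinNonUmbilic (L : List THLetter) : QMvPoly :=
  QMvPoly.mul (V L (.W 0 0 1 0 0) ++ QMvPoly.smul (-1) (V L (.W 1 0 0 1 0))) (V L (.W 0 0 1 0 0) ++ QMvPoly.smul (-1) (V L (.W 1 0 0 1 0)))
    ++ QMvPoly.smul 4 (QMvPoly.mul (V L (.W 0 0 0 1 0)) (V L (.W 0 0 0 1 0)))

section Datum

variable {L : List THLetter} (hL : lettersOK L = true)
  {u : ℝ → EuclideanSpace ℝ (Fin 3) → EuclideanSpace ℝ (Fin 3)} {μ A : ℝ → ℝ → ℝ}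
  {U : Set (ℝ × EuclideanSpace ℝ (Fin 3))} (hU : IsOpen U) (hu : AnalyticOnNhd ℝ (uncurry u) U)
  (hμ : ∀ p ∈ U, AnalyticAt ℝ (uncurry μ) (p.1, p.2 2))

include hL hu hμ in
/-- **The steady laws vanish on `U`** when `u₂` and `μ` do not depend on time there. [folklore] -/
theorem steadyLaws_vanish (hut : ∀ p ∈ U, deriv (fun s => u s p.2 2) p.1 = 0) (hμt : ∀ p ∈ U, deriv (fun s => μ s (p.2 2)) p.1 = 0) :
    ∀ T ∈ steadyLaws L, ∀ p ∈ U, ev L.length T (jetMapOf L u μ A p) = 0 := by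
  have m := fun ℓ (h : ℓ ∈ baseLetters) => mem_of_lettersOK hL h
  intro T hT p hp
  simp only [steadyLaws, List.mem_cons, List.mem_nil_iff, or_false] at hT
  rcases hT with rfl | rfl
  · rw [ev_V (m _ (by simp [baseLetters])), letterFn_Wt hu 2 hp]; exact hut p hp
  · rw [ev_V (m _ (by simp [baseLetters])), letterFn_M10 hμ hp]; exact hμt p hp

include hL hu in
/-- **The non-umbilic pin is non-zero at `p₀`** under the registered disjunction `∂₀u₀(p₀) ≠ ∂₁u₁(p₀) ∨ ∂₁u₀(p₀) ≠ 0`. [folklore] -/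
theorem pinNonUmbilic_ne_zero {p₀ : ℝ × EuclideanSpace ℝ (Fin 3)} (hp₀ : p₀ ∈ U)
    (hNU : fderiv ℝ (u p₀.1) p₀.2 (EuclideanSpace.single 0 1) 0 ≠ fderiv ℝ (u p₀.1) p₀.2 (EuclideanSpace.single 1 1) 1 ∨
      fderiv ℝ (u p₀.1) p₀.2 (EuclideanSpace.single 1 1) 0 ≠ 0) :
    ev L.length (pinNonUmbilic L) (jetMapOf L u μ A p₀) ≠ 0 := by
  have m := fun ℓ (h : ℓ ∈ baseLetters) => mem_of_lettersOK hL h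
  rw [pinNonUmbilic, ev_append, ev_smul, ev_mul, ev_mul, ev_append, ev_smul, ev_V (m _ (by simp [baseLetters])),
    ev_V (m _ (by simp [baseLetters])), ev_V (m _ (by simp [baseLetters])), letterFn_Wx hu 0 hp₀, letterFn_Wy hu 1 hp₀, letterFn_Wy hu 0 hp₀]
  push_cast
  set a := fderiv ℝ (u p₀.1) p₀.2 (EuclideanSpace.single 0 1) 0 with ha
  set b := fderiv ℝ (u p₀.1) p₀.2 (EuclideanSpace.single 1 1) 1 with hb
  set c := fderiv ℝ (u p₀.1) p₀.2 (EuclideanSpace.single 1 1) 0 with hc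
  intro h
  have h' : (a - b) ^ 2 + 4 * c ^ 2 = 0 := by linear_combination h
  have hab : a - b = 0 := by nlinarith [sq_nonneg (a - b), sq_nonneg c]
  have hc0 : c = 0 := by nlinarith [sq_nonneg (a - b), sq_nonneg c]
  rcases hNU with h1 | h1
  · exact h1 (sub_eq_zero.1 hab)
  · exact h1 hc0

end Datum

/-! ### The steady non-umbilic datum and the closers -/

/-- **The (TH) local datum of the STEADY, NON-UMBILIC sub-case**: hypothesis laws `thHyps L ++ steadyLaws L`, pins `thPins L ++ [pinNonUmbilic L]`.
[folklore] -/
theorem thSteadyNULocalDatum (L : List THLetter) (hL : lettersOK L = true)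
    {u : ℝ → EuclideanSpace ℝ (Fin 3) → EuclideanSpace ℝ (Fin 3)} {μ A : ℝ → ℝ → ℝ}
    {U : Set (ℝ × EuclideanSpace ℝ (Fin 3))} {p₀ : ℝ × EuclideanSpace ℝ (Fin 3)} (hU : IsOpen U) (hp₀ : p₀ ∈ U)
    (hu : AnalyticOnNhd ℝ (Function.uncurry u) U)
    (hμ : ∀ p ∈ U, AnalyticAt ℝ (Function.uncurry μ) (p.1, p.2 2)) (hA : ∀ p ∈ U, AnalyticAt ℝ (Function.uncurry A) (p.1, p.2 2))
    (hpol : ∀ p ∈ U, fderiv ℝ (u p.1) p.2 (EuclideanSpace.single 0 1) 1 = fderiv ℝ (u p.1) p.2 (EuclideanSpace.single 1 1) 0)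
    (hdiv : ∀ p ∈ U, fderiv ℝ (u p.1) p.2 (EuclideanSpace.single 0 1) 0 + fderiv ℝ (u p.1) p.2 (EuclideanSpace.single 1 1) 1 +
      fderiv ℝ (u p.1) p.2 (EuclideanSpace.single 2 1) 2 = 0)
    (hsh : ∀ p ∈ U, ∀ b : Fin 3, b ≠ 2 →
      fderiv ℝ (u p.1) p.2 (EuclideanSpace.single 2 1) b = μ p.1 (p.2 2) * fderiv ℝ (u p.1) p.2 (EuclideanSpace.single b 1) 2)
    (hE : ∀ p ∈ U,
      (1 - μ p.1 (p.2 2)) *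
          (deriv (fun s => u s p.2 2) p.1 + fderiv ℝ (fun y => u p.1 y 2) p.2 (u p.1 p.2) - Δ (fun y => u p.1 y 2) p.2) =
        A p.1 (p.2 2) + (deriv (fun s => μ s (p.2 2)) p.1 - deriv (deriv (μ p.1)) (p.2 2)) * u p.1 p.2 2
          + deriv (μ p.1) (p.2 2) / 2 * u p.1 p.2 2 ^ 2 - 2 * deriv (μ p.1) (p.2 2) * fderiv ℝ (u p.1) p.2 (EuclideanSpace.single 2 1) 2)
    (htw : fderiv ℝ (fun y => fderiv ℝ (u p₀.1) y (EuclideanSpace.single 2 1) 2) p₀.2 (EuclideanSpace.single 0 1) *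
            fderiv ℝ (u p₀.1) p₀.2 (EuclideanSpace.single 1 1) 2 -
          fderiv ℝ (fun y => fderiv ℝ (u p₀.1) y (EuclideanSpace.single 2 1) 2) p₀.2 (EuclideanSpace.single 1 1) *
            fderiv ℝ (u p₀.1) p₀.2 (EuclideanSpace.single 0 1) 2 ≠ 0)
    (hm0 : μ p₀.1 (p₀.2 2) ≠ 0) (hm1 : μ p₀.1 (p₀.2 2) ≠ 1) (hmz : deriv (μ p₀.1) (p₀.2 2) ≠ 0)
    (hNU : fderiv ℝ (u p₀.1) p₀.2 (EuclideanSpace.single 0 1) 0 ≠ fderiv ℝ (u p₀.1) p₀.2 (EuclideanSpace.single 1 1) 1 ∨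
      fderiv ℝ (u p₀.1) p₀.2 (EuclideanSpace.single 1 1) 0 ≠ 0)
    (hut : ∀ p ∈ U, deriv (fun s => u s p.2 2) p.1 = 0) (hμt : ∀ p ∈ U, deriv (fun s => μ s (p.2 2)) p.1 = 0) :
    LocalDatum L.length (tableOf L) (maskOf L) dirVec (thHyps L ++ steadyLaws L) (thPins L ++ [pinNonUmbilic L]) :=
  thLocalDatum_with L hL hU hp₀ hu hμ hA hpol hdiv hsh hE htw hm0 hm1 hmz (steadyLaws L) [pinNonUmbilic L]
    (steadyLaws_vanish hL hu hμ hut hμt)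
    (fun π hπ => by
      simp only [List.mem_cons, List.mem_nil_iff, or_false] at hπ
      subst hπ
      exact pinNonUmbilic_ne_zero hL hu hp₀ hNU)

/-- A checked tree WITH cancellation nodes against the steady non-umbilic hypotheses (extended by certified laws `Ts`) closes the goal. [folklore] -/
theorem steadyNU_false_of_checkTreeC (L : List THLetter) (Ts : List QMvPoly) (t : CertTreeC)
    (ht : checkTreeC L.length (tableOf L) (maskOf L) (thHyps L ++ steadyLaws L ++ Ts) (thPins L ++ [pinNonUmbilic L]) t = true)
    (hdat : LocalDatum (E := ℝ × EuclideanSpace ℝ (Fin 3)) L.length (tableOf L) (maskOf L) dirVec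
      (thHyps L ++ steadyLaws L ++ Ts) (thPins L ++ [pinNonUmbilic L])) : False :=
  not_localDatum_of_checkTreeC t _ _ ht hdat

/-- A checked plain v3 tree against the steady non-umbilic hypotheses (extended by certified laws `Ts`) closes the goal. [folklore] -/
theorem steadyNU_false_of_checkTreeS (L : List THLetter) (Ts : List QMvPoly) (t : CertTree)
    (ht : checkTreeS L.length (tableOf L) (maskOf L) (thHyps L ++ steadyLaws L ++ Ts) (thPins L ++ [pinNonUmbilic L]) t = true)
    (hdat : LocalDatum (E := ℝ × EuclideanSpace ℝ (Fin 3)) L.length (tableOf L) (maskOf L) dirVec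
      (thHyps L ++ steadyLaws L ++ Ts) (thPins L ++ [pinNonUmbilic L])) : False :=
  not_localDatum_of_checkTreeS t _ _ ht hdat

/-- **THE BY-NAME TEMPLATE: the STEADY sub-case of the registered stub `stub_localTHEmptyHypNUG` (twist_split v4.2) FROM A CHECKED TREE.**
The statement is the registered one, hypothesis for hypothesis, with two more hypotheses before `False` — `∂ₜu₂ ≡ 0` and `∂ₜμ ≡ 0` on `U` — and it
follows from any certificate tree `t` (cancellation nodes allowed, no chunks) with
`checkTreeC … (thHyps L ++ steadyLaws L) (thPins L ++ [pinNonUmbilic L]) t = true`.  (The rest-frame hypothesis `u(p₀) = 0` is carried, unused: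
certificates are Galilean-blind.) [folklore] -/
theorem steady_localTHEmptyHypNUG_of_checkTreeC (L : List THLetter) (hL : lettersOK L = true) (t : CertTreeC)
    (ht : checkTreeC L.length (tableOf L) (maskOf L) (thHyps L ++ steadyLaws L) (thPins L ++ [pinNonUmbilic L]) t = true) :
    ∀ (u : ℝ → EuclideanSpace ℝ (Fin 3) → EuclideanSpace ℝ (Fin 3)) (μ A : ℝ → ℝ → ℝ)
      (U : Set (ℝ × EuclideanSpace ℝ (Fin 3))) (p₀ : ℝ × EuclideanSpace ℝ (Fin 3)),
      IsOpen U → p₀ ∈ U →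
      AnalyticOnNhd ℝ (Function.uncurry u) U →
      (∀ p ∈ U, AnalyticAt ℝ (Function.uncurry μ) (p.1, p.2 2)) →
      (∀ p ∈ U, AnalyticAt ℝ (Function.uncurry A) (p.1, p.2 2)) →
      (∀ p ∈ U, fderiv ℝ (u p.1) p.2 (EuclideanSpace.single 0 1) 1 = fderiv ℝ (u p.1) p.2 (EuclideanSpace.single 1 1) 0) →
      (∀ p ∈ U, fderiv ℝ (u p.1) p.2 (EuclideanSpace.single 0 1) 0 + fderiv ℝ (u p.1) p.2 (EuclideanSpace.single 1 1) 1 +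
        fderiv ℝ (u p.1) p.2 (EuclideanSpace.single 2 1) 2 = 0) →
      (∀ p ∈ U, ∀ b : Fin 3, b ≠ 2 →
        fderiv ℝ (u p.1) p.2 (EuclideanSpace.single 2 1) b =
          μ p.1 (p.2 2) * fderiv ℝ (u p.1) p.2 (EuclideanSpace.single b 1) 2) →
      (∀ p ∈ U,
        (1 - μ p.1 (p.2 2)) *
            (deriv (fun s => u s p.2 2) p.1 + fderiv ℝ (fun y => u p.1 y 2) p.2 (u p.1 p.2)
              - Δ (fun y => u p.1 y 2) p.2) =
          A p.1 (p.2 2) + (deriv (fun s => μ s (p.2 2)) p.1 - deriv (deriv (μ p.1)) (p.2 2)) * u p.1 p.2 2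
            + deriv (μ p.1) (p.2 2) / 2 * u p.1 p.2 2 ^ 2
            - 2 * deriv (μ p.1) (p.2 2) * fderiv ℝ (u p.1) p.2 (EuclideanSpace.single 2 1) 2) →
      fderiv ℝ (fun y => fderiv ℝ (u p₀.1) y (EuclideanSpace.single 2 1) 2) p₀.2 (EuclideanSpace.single 0 1) *
            fderiv ℝ (u p₀.1) p₀.2 (EuclideanSpace.single 1 1) 2 -
          fderiv ℝ (fun y => fderiv ℝ (u p₀.1) y (EuclideanSpace.single 2 1) 2) p₀.2 (EuclideanSpace.single 1 1) *
            fderiv ℝ (u p₀.1) p₀.2 (EuclideanSpace.single 0 1) 2 ≠ 0 →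
      μ p₀.1 (p₀.2 2) ≠ 0 → μ p₀.1 (p₀.2 2) ≠ 1 → deriv (μ p₀.1) (p₀.2 2) ≠ 0 →
      μ p₀.1 (p₀.2 2) < 0 →
      (fderiv ℝ (u p₀.1) p₀.2 (EuclideanSpace.single 0 1) 0 ≠ fderiv ℝ (u p₀.1) p₀.2 (EuclideanSpace.single 1 1) 1 ∨
        fderiv ℝ (u p₀.1) p₀.2 (EuclideanSpace.single 1 1) 0 ≠ 0) →
      u p₀.1 p₀.2 = 0 →
      (∀ p ∈ U, deriv (fun s => u s p.2 2) p.1 = 0) → (∀ p ∈ U, deriv (fun s => μ s (p.2 2)) p.1 = 0) → False := by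
  intro u μ A U p₀ hU hp₀ hu hμ hA hpol hdiv hsh hE htw hm0 hm1 hmz _hneg hNU _hrest hut hμt
  have d0 := thSteadyNULocalDatum L hL hU hp₀ hu hμ hA hpol hdiv hsh hE htw hm0 hm1 hmz hNU hut hμt
  exact steadyNU_false_of_checkTreeC L [] t (by simpa using ht) (by simpa using d0)

end Summit.NavierStokesRegularity.NavierStokesRegularity.Theorems.PoloidalWindowDoorLrcModEntireTHCertSteady

end
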